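import Mathlib

/-!
# Route LiouvilleSarnak — crux `LiouvilleCutRank` (stmt-ValiantsHypothesis-14775): the TWO-ADIC TWIN of `λ`
# — the multiplicative barrier of the aligned rung does NOT extend to interleaved (bounded-run) cuts

`Theorems/LiouvilleSarnakLiouvilleCutRankMultiplicativeBarrier.lean` (p825227): a completely multiplicative,
`2`-automatic `±1` function (a `2`-adically twisted character) has ALIGNED cut rank `≤ 4` at every level, so the
aligned rung of the crux needs information separating `λ` from such functions (and it was proved from Coons'
non-automaticity).  The census of the item (leafhand-2 g5, 2026-08-31) locates the remaining OPEN class of the crux at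
the opposite end: balanced BOUNDED-RUN cut words (the bit-interleaving `(CR)^n`, Thue–Morse type words, …).  This file
records, as theorems, that there the multiplicative barrier is absent already for the simplest twin of `λ`, the
two-adic sign `f₀(m) = (-1)^{v₂(m)}` — completely multiplicative, `2`-automatic, `f₀(2) = λ(2) = -1`, `f₀(p) = +1` at
every odd prime:

* `twoAdicSign_mul`, `twoAdicSign_two`, `twoAdicSign_odd` — `f₀` is completely multiplicative with `f₀(2) = -1` and
  `f₀ = 1` on odd numbers (§1);
* ★ `succ_le_rank_interleaved_twoAdicSign` — on the bit-interleaving cut at level `n` (row bit `i` at position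
  `2i+1`, column bit `i` at position `2i`) the cut matrix `(f₀(N_π(r,c)+1))_{r,c}` has rank `≥ n + 1`: on the prefix
  rows `1^i 0^{n-i}` and prefix columns `1^k 0^{n-k}` (`i, k ≤ n`) the entry is `+1` if `k ≤ i` and `-1` if `k > i`
  (`N + 1 = 2^{2k} · odd`, resp. `2^{2i+1} · odd`, §2), an `(n+1) × (n+1)` matrix `S` with `S v = 0 ⇒ v = 0` (§3);
* ★ `rank_aligned_twoAdicSign_le_two` — on the ALIGNED cut `(f₀(a + 2^n b + 1))_{a,b<2^n}` every row `a < 2^n - 1`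
  is constant (`v₂(a + 1 + 2^n b) = v₂(a + 1)`), so the rank is `≤ 2` at every level (§4).

Reading (honest framing).  The numbers accompanying this file (folder `numerics/` of the session, quoted on the item):
among ALL completely multiplicative `f : [1, 64] → {±1}` with `f(2) = -1` (`2^17` sign patterns, exhaustive) the minimum
cut rank at level `3` is `4 = n+1` on `(CR)^3` and `3` on the Thue–Morse word, attained by `f₀` / twisted characters
mod `8`; among the `256` prime-sign patterns mod `16` at levels `5, 6` only the four characters mod `8` have rank `< 2^n`
(all others are nonsingular), and those have rank `n+1 … 2n`; annealing over all primes `≤ 4^5` finds nothing lower.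
So for bounded-run words no completely multiplicative twin of `λ` with small cut rank is known — in contrast with the
aligned rung — and the residual class of the crux is consistent with a purely multiplicative mechanism
("CONJECTURE C": for every cut word `w` and every completely multiplicative `±1`-valued `f` with `f(2) = -1`,
`rank ≥ c · #runs(w)`; for `f = λ` this is the residual class of `LiouvilleCutRank`).  Nothing here is a case of the
crux; `LiouvilleCutRank`, `DigitalBilinearLiouville`, `AlgebraicSarnak` stay OPEN; nothing bears on `VP ≠ VNP`.
No definitions (`f₀` is the explicit term `(-1) ^ (m.factorization 2)`, written in `ℂ` for the matrices).
-/

set_option linter.dupNamespace false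

noncomputable section

namespace Summit.ValiantsHypothesis.ValiantsHypothesis.Theorems.LiouvilleSarnakLiouvilleCutRank.TwoAdicTwin

open Finset

/-! ### §1 The two-adic sign `f₀(m) = (-1)^{v₂(m)}` -/

/-- `v₂(2^v · M) = v` for odd `M`. [folklore] -/
theorem factorization_two_pow_mul_odd (v M : ℕ) (hM : M % 2 = 1) : (2 ^ v * M).factorization 2 = v := by
  have hM0 : M ≠ 0 := by intro h; simp [h] at hM
  rw [Nat.factorization_mul (pow_ne_zero _ two_ne_zero) hM0, Finsupp.add_apply,
    Nat.Prime.factorization_pow Nat.prime_two, Finsupp.single_eq_same,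
    Nat.factorization_eq_zero_of_not_dvd (fun h => by omega), add_zero]

/-- `f₀(2^v · M) = (-1)^v` for odd `M` (in any ring). [folklore] -/
theorem twoAdicSign_two_pow_mul_odd {R : Type*} [Ring R] (v M : ℕ) (hM : M % 2 = 1) :
    (-1 : R) ^ ((2 ^ v * M).factorization 2) = (-1) ^ v := by
  rw [factorization_two_pow_mul_odd v M hM]

/-- `f₀` is completely multiplicative: `f₀(a b) = f₀(a) f₀(b)` (`a, b ≥ 1`; in any ring). [folklore] -/
theorem twoAdicSign_mul {R : Type*} [Ring R] (a b : ℕ) (ha : a ≠ 0) (hb : b ≠ 0) :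
    (-1 : R) ^ ((a * b).factorization 2) = (-1) ^ (a.factorization 2) * (-1) ^ (b.factorization 2) := by
  rw [Nat.factorization_mul ha hb, Finsupp.add_apply, pow_add]

/-- `f₀(2) = -1 = λ(2)` (in any ring). [folklore] -/
theorem twoAdicSign_two {R : Type*} [Ring R] : (-1 : R) ^ ((2 : ℕ).factorization 2) = -1 := by
  rw [Nat.Prime.factorization_self Nat.prime_two, pow_one]

/-- `f₀(M) = 1` for every odd `M` (so `f₀(p) = 1 ≠ λ(p) = -1` at every odd prime `p`; in any ring).
[folklore] -/
theorem twoAdicSign_odd {R : Type*} [Ring R] (M : ℕ) (hM : M % 2 = 1) : (-1 : R) ^ (M.factorization 2) = 1 := by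
  have h := factorization_two_pow_mul_odd 0 M hM
  rw [pow_zero, one_mul] at h
  rw [h, pow_zero]

/-! ### §2 Low bits: `ofBits f + 1 = 2^t · odd` when the bits below `t` are `1` and bit `t` is `0` -/

/-- If the bits of `f` below `t` are `1` and bit `t` (if `t < L`) is `0`, then `ofBits f ≡ 2^t - 1 (mod 2^{t+1})`.
[folklore] -/
theorem ofBits_mod_two_pow_succ {L : ℕ} (f : Fin L → Bool) (t : ℕ) (ht : t ≤ L)
    (h1 : ∀ j : Fin L, (j : ℕ) < t → f j = true) (h0 : ∀ j : Fin L, (j : ℕ) = t → f j = false) :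
    Nat.ofBits f % 2 ^ (t + 1) = 2 ^ t - 1 := by
  apply Nat.eq_of_testBit_eq
  intro i
  rw [Nat.testBit_mod_two_pow, Nat.testBit_two_pow_sub_one, Nat.testBit_ofBits]
  by_cases hit : i < t
  · have hiL : i < L := lt_of_lt_of_le hit ht
    rw [dif_pos hiL, h1 ⟨i, hiL⟩ hit]
    have : i < t + 1 := by omega
    simp [this, hit]
  · by_cases hi : i = t
    · subst hi
      by_cases hiL : i < L
      · rw [dif_pos hiL, h0 ⟨i, hiL⟩ rfl]
        simp
      · rw [dif_neg hiL]
        simp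
    · have h' : ¬ i < t + 1 := by omega
      simp [h', hit]

/-- Under the same hypotheses `ofBits f + 1 = 2^t · (2X + 1)` with `X = ofBits f / 2^{t+1}`. [folklore] -/
theorem ofBits_succ_eq_two_pow_mul_odd {L : ℕ} (f : Fin L → Bool) (t : ℕ) (ht : t ≤ L)
    (h1 : ∀ j : Fin L, (j : ℕ) < t → f j = true) (h0 : ∀ j : Fin L, (j : ℕ) = t → f j = false) :
    Nat.ofBits f + 1 = 2 ^ t * (2 * (Nat.ofBits f / 2 ^ (t + 1)) + 1) := by
  have hmod := ofBits_mod_two_pow_succ f t ht h1 h0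
  have hdiv := Nat.mod_add_div (Nat.ofBits f) (2 ^ (t + 1))
  rw [hmod] at hdiv
  generalize Nat.ofBits f / 2 ^ (t + 1) = X at hdiv ⊢
  rw [pow_succ] at hdiv
  have h2t : 1 ≤ 2 ^ t := Nat.one_le_two_pow
  zify [h2t] at hdiv ⊢
  linear_combination (-1 : ℤ) * hdiv

/-- Hence `f₀(ofBits f + 1) = (-1)^t`: the two-adic sign of `N + 1` is read off the number `t` of trailing ones
of `N`. [folklore] -/
theorem twoAdicSign_ofBits_succ {R : Type*} [Ring R] {L : ℕ} (f : Fin L → Bool) (t : ℕ) (ht : t ≤ L)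
    (h1 : ∀ j : Fin L, (j : ℕ) < t → f j = true) (h0 : ∀ j : Fin L, (j : ℕ) = t → f j = false) :
    (-1 : R) ^ ((Nat.ofBits f + 1).factorization 2) = (-1) ^ t := by
  rw [ofBits_succ_eq_two_pow_mul_odd f t ht h1 h0]
  exact twoAdicSign_two_pow_mul_odd t _ (by omega)

/-! ### §3 The bit-interleaving cut: rank `≥ n + 1` -/

/-- ★ **The two-adic twin has interleaved cut rank `≥ n + 1`.**  For the bit-interleaving cut at level `n`
(row bit `i` at position `2i+1`, column bit `i` at position `2i`), the cut matrix of `f₀(m) = (-1)^{v₂(m)}` —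
`(f₀(N_π(r,c) + 1))_{r,c}` — has rank at least `n + 1`: its `(n+1) × (n+1)` submatrix on the prefix rows and
prefix columns `1^i 0^{n-i}` is the nonsingular sign matrix `[k ≤ i] - [k > i]`. [this file] -/
theorem succ_le_rank_interleaved_twoAdicSign (n : ℕ) (π : Fin n ⊕ Fin n ≃ Fin (2 * n))
    (hπ : ∀ i : Fin n, (π (Sum.inl i) : ℕ) = 2 * i + 1 ∧ (π (Sum.inr i) : ℕ) = 2 * i) :
    n + 1 ≤ (Matrix.of fun r c : Fin n → Bool =>
      (-1 : ℂ) ^ ((Nat.ofBits (fun k : Fin (2 * n) => Sum.elim r c (π.symm k)) + 1).factorization 2)).rank := by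
  classical
  set M := (Matrix.of fun r c : Fin n → Bool =>
      (-1 : ℂ) ^ ((Nat.ofBits (fun k : Fin (2 * n) => Sum.elim r c (π.symm k)) + 1).factorization 2)) with hM
  -- prefix rows / columns `1^i 0^{n-i}`
  let ρ : Fin (n + 1) → (Fin n → Bool) := fun i t => decide ((t : ℕ) < i)
  -- positions of the bits
  have hposl : ∀ (j : Fin (2 * n)) (t : Fin n), π.symm j = Sum.inl t → (j : ℕ) = 2 * t + 1 := by
    intro j t h
    have : π (Sum.inl t) = j := by rw [← h, Equiv.apply_symm_apply]
    rw [← this]; exact (hπ t).1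
  have hposr : ∀ (j : Fin (2 * n)) (t : Fin n), π.symm j = Sum.inr t → (j : ℕ) = 2 * t := by
    intro j t h
    have : π (Sum.inr t) = j := by rw [← h, Equiv.apply_symm_apply]
    rw [← this]; exact (hπ t).2
  -- entries of the submatrix
  have hentry : ∀ i k : Fin (n + 1), M (ρ i) (ρ k) = if (k : ℕ) ≤ i then (1 : ℂ) else -1 := by
    intro i k
    simp only [hM, Matrix.of_apply]
    by_cases hki : (k : ℕ) ≤ i
    · have hk2 : 2 * (k : ℕ) ≤ 2 * n := by have := k.isLt; omega
      rw [twoAdicSign_ofBits_succ (R := ℂ) _ (2 * k) hk2]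
      · rw [if_pos hki, pow_mul]; norm_num
      · intro j hj
        rcases h : π.symm j with t | t
        · have := hposl j t h; simp only [Sum.elim_inl, ρ, decide_eq_true_eq]; omega
        · have := hposr j t h; simp only [Sum.elim_inr, ρ, decide_eq_true_eq]; omega
      · intro j hj
        rcases h : π.symm j with t | t
        · have := hposl j t h; omega
        · have := hposr j t h; simp only [Sum.elim_inr, ρ, decide_eq_false_iff_not]; omega
    · have hi2 : 2 * (i : ℕ) + 1 ≤ 2 * n := by have := k.isLt; omega
      rw [twoAdicSign_ofBits_succ (R := ℂ) _ (2 * i + 1) hi2]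
      · rw [if_neg hki, pow_succ, pow_mul]; norm_num
      · intro j hj
        rcases h : π.symm j with t | t
        · have := hposl j t h; simp only [Sum.elim_inl, ρ, decide_eq_true_eq]; omega
        · have := hposr j t h; simp only [Sum.elim_inr, ρ, decide_eq_true_eq]; omega
      · intro j hj
        rcases h : π.symm j with t | t
        · have := hposl j t h; simp only [Sum.elim_inl, ρ, decide_eq_false_iff_not]; omega
        · have := hposr j t h; omega
  -- the sign matrix `S`
  set S : Matrix (Fin (n + 1)) (Fin (n + 1)) ℂ := Matrix.of fun i k => if (k : ℕ) ≤ i then (1 : ℂ) else -1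
    with hS
  have hsub : M.submatrix ρ ρ = S := by
    ext i k
    rw [Matrix.submatrix_apply, hentry, hS, Matrix.of_apply]
  -- `S u = 0 ⇒ u = 0`
  have hker : ∀ u : Fin (n + 1) → ℂ, S.mulVec u = 0 → u = 0 := by
    intro u hu
    have hSu : ∀ i : Fin (n + 1), (∑ k : Fin (n + 1), if (k : ℕ) ≤ i then u k else -u k) = 0 := by
      intro i
      have h := congrFun hu i
      simp only [Matrix.mulVec, dotProduct, hS, Matrix.of_apply, Pi.zero_apply] at h
      rw [← h]
      refine Finset.sum_congr rfl fun k _ => ?_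
      split_ifs <;> ring
    -- successive differences kill `u i` for `i ≥ 1`
    have hupos : ∀ i : Fin (n + 1), 0 < (i : ℕ) → u i = 0 := by
      intro i hi
      let i' : Fin (n + 1) := ⟨(i : ℕ) - 1, by omega⟩
      have hd : (∑ k : Fin (n + 1), (if (k : ℕ) ≤ i then u k else -u k)) -
          (∑ k : Fin (n + 1), (if (k : ℕ) ≤ i' then u k else -u k)) = 2 * u i := by
        rw [← Finset.sum_sub_distrib, Finset.sum_eq_single i]
        · have h1 : (i : ℕ) ≤ i := le_rfl
          have h2 : ¬ (i : ℕ) ≤ i' := by show ¬ (i : ℕ) ≤ (i : ℕ) - 1; omega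
          rw [if_pos h1, if_neg h2]; ring
        · intro k _ hk
          have hk' : (k : ℕ) ≠ i := fun h => hk (Fin.ext h)
          by_cases hlt : (k : ℕ) < i
          · have h1 : (k : ℕ) ≤ i := hlt.le
            have h2 : (k : ℕ) ≤ i' := by show (k : ℕ) ≤ (i : ℕ) - 1; omega
            rw [if_pos h1, if_pos h2, sub_self]
          · have h1 : ¬ (k : ℕ) ≤ i := by omega
            have h2 : ¬ (k : ℕ) ≤ i' := by show ¬ (k : ℕ) ≤ (i : ℕ) - 1; omega
            rw [if_neg h1, if_neg h2, sub_self]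
        · intro h; exact absurd (Finset.mem_univ i) h
      rw [hSu i, hSu i', sub_self] at hd
      have h2 : (2 : ℂ) * u i = 0 := hd.symm
      simpa using h2
    have hu0 : ∀ i : Fin (n + 1), (i : ℕ) = 0 → u i = 0 := by
      intro i hi
      have h := hSu i
      rw [Finset.sum_eq_single i] at h
      · simpa using h
      · intro k _ hk
        have hk' : 0 < (k : ℕ) := by
          have : (k : ℕ) ≠ i := fun h => hk (Fin.ext h)
          omega
        rw [hupos k hk']; simp
      · intro h'; exact absurd (Finset.mem_univ i) h'
    funext k
    by_cases hk : (k : ℕ) = 0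
    · exact hu0 k hk
    · exact hupos k (Nat.pos_of_ne_zero hk)
  have hinj : Function.Injective S.mulVec := by
    intro v w hvw
    have h0 : S.mulVec (v - w) = 0 := by rw [Matrix.mulVec_sub, hvw, sub_self]
    exact sub_eq_zero.mp (hker _ h0)
  have hunit : IsUnit S := Matrix.mulVec_injective_iff_isUnit.mp hinj
  calc n + 1 = Fintype.card (Fin (n + 1)) := (Fintype.card_fin _).symm
    _ = S.rank := (Matrix.rank_of_isUnit S hunit).symm
    _ = (M.submatrix ρ ρ).rank := by rw [hsub]
    _ ≤ M.rank := Matrix.rank_submatrix_le M ρ ρ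

/-! ### §4 The aligned cut: rank `≤ 2` -/

/-- ★ **The two-adic twin has aligned cut rank `≤ 2`.**  Every row `a < 2^n - 1` of the aligned matrix
`(f₀(a + 2^n b + 1))_{a,b<2^n}` is constant (`v₂(a + 1 + 2^n b) = v₂(a + 1) < n`), so the matrix is the sum of two
outer products (the constant rows, and the last row) and its rank is `≤ 2` at every level `n` — whereas for `λ` the
aligned ranks are unbounded (`AlignedCutRank`). [this file] -/
theorem rank_aligned_twoAdicSign_le_two (n : ℕ) :
    (Matrix.of fun a b : Fin (2 ^ n) =>
      (-1 : ℂ) ^ (((a : ℕ) + 2 ^ n * (b : ℕ) + 1).factorization 2)).rank ≤ 2 := by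
  classical
  set A := (Matrix.of fun a b : Fin (2 ^ n) =>
      (-1 : ℂ) ^ (((a : ℕ) + 2 ^ n * (b : ℕ) + 1).factorization 2)) with hA
  have hlast : 2 ^ n - 1 < 2 ^ n := Nat.sub_lt (Nat.two_pow_pos n) Nat.one_pos
  let aL : Fin (2 ^ n) := ⟨2 ^ n - 1, hlast⟩
  -- every other row is the constant `f₀(a + 1)`
  have hrow : ∀ a : Fin (2 ^ n), a ≠ aL → ∀ b : Fin (2 ^ n),
      A a b = (-1 : ℂ) ^ (((a : ℕ) + 1).factorization 2) := by
    intro a haL b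
    have ha : (a : ℕ) + 1 < 2 ^ n := by
      have h1 := a.isLt
      have h2 : (a : ℕ) ≠ 2 ^ n - 1 := fun h => haL (Fin.ext (by simp only [aL]; exact h))
      omega
    obtain ⟨v, hv⟩ : ∃ v : ℕ, v = ((a : ℕ) + 1).factorization 2 := ⟨_, rfl⟩
    obtain ⟨M, hMdef⟩ : ∃ M : ℕ, M = ((a : ℕ) + 1) / 2 ^ v := ⟨_, rfl⟩
    have hvM : (a : ℕ) + 1 = 2 ^ v * M := by
      subst hMdef; subst hv
      exact (Nat.ordProj_mul_ordCompl_eq_self ((a : ℕ) + 1) 2).symm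
    have hM : M % 2 = 1 := by
      subst hMdef; subst hv
      have h := Nat.not_dvd_ordCompl Nat.prime_two (show (a : ℕ) + 1 ≠ 0 by omega)
      omega
    have hM0 : 1 ≤ M := by omega
    have hv_lt : v < n := by
      by_contra h
      rw [not_lt] at h
      have h1 : 2 ^ n ≤ 2 ^ v := Nat.pow_le_pow_right (by norm_num) h
      have h2 : 2 ^ v ≤ 2 ^ v * M := Nat.le_mul_of_pos_right _ hM0
      omega
    simp only [hA, Matrix.of_apply]
    obtain ⟨d, hd⟩ : ∃ d, n = v + (d + 1) := ⟨n - v - 1, by omega⟩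
    have heq : (a : ℕ) + 2 ^ n * (b : ℕ) + 1 = 2 ^ v * (M + 2 ^ d * 2 * (b : ℕ)) := by
      have h2n : (2 : ℤ) ^ n = 2 ^ v * (2 ^ d * 2) := by rw [hd, pow_add, pow_succ]
      have hvM' : ((a : ℕ) : ℤ) + 1 = 2 ^ v * (M : ℤ) := by exact_mod_cast hvM
      zify
      linear_combination hvM' + ((b : ℕ) : ℤ) * h2n
    have hodd : (M + 2 ^ d * 2 * (b : ℕ)) % 2 = 1 := by
      have h' : 2 ^ d * 2 * (b : ℕ) = 2 * (2 ^ d * (b : ℕ)) := by ring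
      omega
    rw [heq, twoAdicSign_two_pow_mul_odd (R := ℂ) v _ hodd, hv]
  -- decomposition into two outer products
  have hdec : A = Matrix.vecMulVec (fun a => if a = aL then 0 else (-1 : ℂ) ^ (((a : ℕ) + 1).factorization 2))
        (fun _ => 1) + Matrix.vecMulVec (fun a => if a = aL then 1 else 0) (fun b => A aL b) := by
    ext a b
    simp only [Matrix.add_apply, Matrix.vecMulVec_apply]
    by_cases haL : a = aL
    · subst haL; simp
    · rw [if_neg haL, if_neg haL, hrow a haL b]; ring
  -- rank is subadditive and outer products have rank `≤ 1`
  have hsub : ∀ B C : Matrix (Fin (2 ^ n)) (Fin (2 ^ n)) ℂ, (B + C).rank ≤ B.rank + C.rank := by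
    intro B C
    unfold Matrix.rank
    rw [Matrix.mulVecLin_add]
    exact (Submodule.finrank_mono (LinearMap.range_add_le _ _)).trans
      (Submodule.finrank_add_le_finrank_add_finrank _ _)
  rw [hdec]
  refine (hsub _ _).trans ?_
  refine (add_le_add (Matrix.rank_vecMulVec_le _ _) (Matrix.rank_vecMulVec_le _ _)).trans ?_
  norm_num

end Summit.ValiantsHypothesis.ValiantsHypothesis.Theorems.LiouvilleSarnakLiouvilleCutRank.TwoAdicTwin
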